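import Summits.HubbardSuperconductivity.HubbardSuperconductivity.Theorems.SoloBlindPenaltyEnergyPrice
import Summits.HubbardSuperconductivity.HubbardSuperconductivity.Theorems.SoloBlindPenaltyCeiling
import HarnessLib

/-!
# Every approximate penalised minimiser with d-wave order carries a small penalty

Solo programme `solo-HubbardSuperconductivity-blind`, structural Theorem 19(e): the penalty
ceiling for the hypotheses of Theorem 19 (`SoloBlindPenaltyEnergyPrice`).

Theorem 19 shows `HubbardSuperconductivity` ⟺ at every large even side `L` there are `s > 0` and
ONE unit vector `χ` of the doped sector `K` (or one canonical sector Gibbs state, at any `β`) with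
d-wave order `≥ c L⁴` whose energy for the PENALISED `B = H_L + s Δ†Δ` is within `s c L⁴ / 2` of
`minEnergyOn B K`. Here we show that EVERY such witness has a small penalty, hence an
`L`-independent energy tolerance:

* `approx_penalised_penalty_ceiling`: `H = hubbardTorus 2 L t U` (`L ≥ 3`), `Δ = pairField g L`
  (`|g| ≤ 1`), joint sector `(N, S^z)` with `N ≥ 2`, nonzero; if a unit `χ` of the sector has
  `re ⟨χ, (H + sΔᴴΔ) χ⟩ ≤ minEnergyOn (H + sΔᴴΔ) K + s c L⁴/2` and `re ⟨χ, ΔᴴΔ χ⟩ ≥ c L⁴`, then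
  `s c L⁴ ≤ 192 π² |t| M²` for every `M < L` with `M c ≥ 2400`.
* `thermal_energy_penalty_ceiling`: the same for the canonical sector Gibbs state of `H + sΔᴴΔ`
  at ANY `β` whose thermal excitation energy is `≤ s c L⁴/2` (times `Z_K`) and whose order is
  `≥ c L⁴`.
* `one_state_energy_tolerance`, `one_gibbs_state_energy_tolerance`: in the summit's normalisation
  (`t = 1`, d-wave, doped `S^z = 0` sector, `L > ⌈2400/c⌉`) every admissible witness of
  Theorem 19 has `s ≤ 192 π² ⌈2400/c⌉² / (c L⁴)` and energy tolerance
  `s c L⁴ / 2 ≤ 96 π² ⌈2400/c⌉²`: the primal form of the summit asks for ONE state matching the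
  penalised sector ground energy to an `L`-INDEPENDENT total energy, never more, never less
  (Theorem 3: a tolerance `ε` forces the multiplier `1/s ≥ (c/2ε) L⁴`).

Proof: with `A = H + (s/4)ΔᴴΔ` and `B = A + (3s/4)ΔᴴΔ`, Theorem 19 (pure / thermal form, tolerance
`s c L⁴/2`, coupling `3s/4`) gives order `≥ c L⁴ − (2/3) c L⁴ = c L⁴/3` on every sector ground
state of `A`; the ground-state penalty ceiling (`penalty_mul_order_le_of_penalised_groundState`,
symmetrised gauge twists, Theorem 18(f)) applied to `A` with `(s/4, c/3)` bounds `s`.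
(A direct twist comparison for an `ε`-approximate minimiser gives only
`s c L⁴ ≤ 16π²|t|M² + 2ε`, vacuous at `ε = s c L⁴/2`; the quarter-penalised detour is needed.)
[this work]
-/

noncomputable section

namespace Summit.HubbardSuperconductivity.HubbardSuperconductivity.Theorems

open Matrix Finset Filter Topology Literature.Probability.LatticeModels
  Literature.MathematicalPhysics.QuantumLattice
  Literature.MathematicalPhysics.QuantumLattice.EigenvalueContinuation
open scoped ComplexOrder

/-- **Penalty ceiling for an approximate penalised minimiser.** `H = hubbardTorus 2 L t U`
(`L = n+1 ≥ 3`), `Δ = pairField g L` with `|g| ≤ 1`, `K` the joint sector `(N, S^z = Mz)` with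
`N ≥ 2`, `K ≠ 0`, `s > 0`. If a unit vector `χ ∈ K` satisfies
`re ⟨χ, (H + sΔᴴΔ) χ⟩ ≤ minEnergyOn (H + sΔᴴΔ) K + s c L⁴ / 2` and `c L⁴ ≤ re ⟨χ, ΔᴴΔ χ⟩`, then
`s c L⁴ ≤ 192 π² |t| M²` for every `M < L` with `M c ≥ 2400`. [this work] -/
theorem approx_penalised_penalty_ceiling {n : ℕ} (hL : 3 ≤ n + 1) (t U : ℝ)
    (g : (Fin 2 → ℤ) → ℝ) (hg : ∀ e, |g e| ≤ 1) {N : ℕ} (hN2 : 2 ≤ N) {Mz : ℝ}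
    (hKne : szSector (Λ := FermionTorus 2 (n + 1)) N Mz ≠ ⊥) {s c : ℝ} (hs : 0 < s)
    {M : ℕ} (hML : M < n + 1) (hMc : 2400 ≤ (M : ℝ) * c)
    {χ : Fock (Orb (FermionTorus 2 (n + 1)))}
    (hχK : χ ∈ szSector (Λ := FermionTorus 2 (n + 1)) N Mz) (hχ1 : star χ ⬝ᵥ χ = 1)
    (hχE : (star χ ⬝ᵥ (hubbardTorus 2 (n + 1) t U + (s : ℂ) •
        ((pairField g (n + 1))ᴴ * pairField g (n + 1))) *ᵥ χ).re ≤
      (hubbardTorus 2 (n + 1) t U + (s : ℂ) •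
          ((pairField g (n + 1))ᴴ * pairField g (n + 1))).minEnergyOn
          (szSector (Λ := FermionTorus 2 (n + 1)) N Mz) +
        s * c * ((n + 1 : ℕ) : ℝ) ^ 4 / 2)
    (hord : c * ((n + 1 : ℕ) : ℝ) ^ 4 ≤
      (star χ ⬝ᵥ ((pairField g (n + 1))ᴴ * pairField g (n + 1)) *ᵥ χ).re) :
    s * c * ((n + 1 : ℕ) : ℝ) ^ 4 ≤ 192 * Real.pi ^ 2 * |t| * (M : ℝ) ^ 2 := by
  set K : Submodule ℂ (Fock (Orb (FermionTorus 2 (n + 1)))) := szSector N Mz with hK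
  set H := hubbardTorus 2 (n + 1) t U with hH
  set Δ := pairField g (n + 1) with hΔ
  set O := Δᴴ * Δ with hO
  -- the quarter-penalised Hamiltonian `A = H + (s/4) O`, with `H + s O = A + (3s/4) O`
  set A := H + ((s / 4 : ℝ) : ℂ) • O with hA
  have hdecomp : H + (s : ℂ) • O = A + ((3 * s / 4 : ℝ) : ℂ) • O := by
    rw [hA, add_assoc, ← add_smul, ← Complex.ofReal_add]
    congr 2
    ring
  have hAh : A.IsHermitian := isHermitian_penalised t U (s / 4) g
  have hOh : O.IsHermitian := isHermitian_conjTranspose_mul_self _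
  have hKA : ∀ v ∈ K, A *ᵥ v ∈ K := fun v hv => penalised_mulVec_mem_szSector t U (s / 4) g hN2 hv
  -- a sector ground state of `A` inherits order `≥ c L⁴ - (s c L⁴/2) / (3s/4) = c L⁴/3`
  obtain ⟨φ, hφK, hφ1, hφA⟩ := exists_unit_eigen_minEnergyOn hAh K hKA hKne
  rw [hdecomp] at hχE
  have hs' : 0 < 3 * s / 4 := by positivity
  have hφO := groundState_re_rayleigh_ge_of_approx_penalised hAh hOh K hs' hχK hχ1 hχE hord
    hφK hφ1 hφA
  have hs0 : s ≠ 0 := hs.ne'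
  have hε : s * c * ((n + 1 : ℕ) : ℝ) ^ 4 / 2 / (3 * s / 4) =
      2 * (c * ((n + 1 : ℕ) : ℝ) ^ 4) / 3 := by
    field_simp
    ring
  rw [hε] at hφO
  have hord' : c / 3 * ((n + 1 : ℕ) : ℝ) ^ 4 ≤ (star (Δ *ᵥ φ) ⬝ᵥ (Δ *ᵥ φ)).re := by
    have h : (star φ ⬝ᵥ (O *ᵥ φ)).re = (star (Δ *ᵥ φ) ⬝ᵥ (Δ *ᵥ φ)).re := by
      rw [hO, ← mulVec_mulVec, dotProduct_mulVec _ Δᴴ, ← star_mulVec]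
    rw [← h]
    linarith
  -- so `φ` is a penalised ground state (coupling `s/4`) with order `≥ (c/3) L⁴`
  have hgs : IsGroundStateInSector
      (hubbardTorus 2 (n + 1) t U + ((s / 4 : ℝ) : ℂ) •
        ((pairField g (n + 1))ᴴ * pairField g (n + 1))) N Mz φ :=
    ⟨hφK, fun h0 => by simp [h0] at hφ1, hφA⟩
  have hMc' : 800 ≤ (M : ℝ) * (c / 3) := by linarith
  have hkey := penalty_mul_order_le_of_penalised_groundState hL t U g hg (s := s / 4) (c := c / 3)
    (by positivity) hML hMc' hgs hφ1 hord'
  linarith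

/-- **Penalty ceiling for the thermal-energy hypothesis.** Same setting; if for some `β` the
canonical sector Gibbs state of `B = H + sΔᴴΔ` has thermal excitation energy
`re tr (P_K e^{-βB} B) ≤ (minEnergyOn B K + s c L⁴/2) · re tr (P_K e^{-βB})` and order
`c L⁴ ≤ re (tr (P_K e^{-βB} ΔᴴΔ) / tr (P_K e^{-βB}))`, then `s c L⁴ ≤ 192 π² |t| M²` for every
`M < L` with `M c ≥ 2400`. [this work] -/
theorem thermal_energy_penalty_ceiling {n : ℕ} (hL : 3 ≤ n + 1) (t U : ℝ)
    (g : (Fin 2 → ℤ) → ℝ) (hg : ∀ e, |g e| ≤ 1) {N : ℕ} (hN2 : 2 ≤ N) {Mz : ℝ}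
    (hKne : szSector (Λ := FermionTorus 2 (n + 1)) N Mz ≠ ⊥) {s c : ℝ} (hs : 0 < s) (β : ℝ)
    {M : ℕ} (hML : M < n + 1) (hMc : 2400 ≤ (M : ℝ) * c)
    (henergy : (projMatrix ((szSector (Λ := FermionTorus 2 (n + 1)) N Mz).map
            ((WithLp.linearEquiv 2 ℂ (Fock (Orb (FermionTorus 2 (n + 1))))).symm :
              Fock (Orb (FermionTorus 2 (n + 1))) →ₗ[ℂ]
                EuclideanSpace ℂ (Finset (Orb (FermionTorus 2 (n + 1)))))) *
          gibbsWeight β (hubbardTorus 2 (n + 1) t U + (s : ℂ) •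
            ((pairField g (n + 1))ᴴ * pairField g (n + 1))) *
          (hubbardTorus 2 (n + 1) t U + (s : ℂ) •
            ((pairField g (n + 1))ᴴ * pairField g (n + 1)))).trace.re ≤
        ((hubbardTorus 2 (n + 1) t U + (s : ℂ) •
            ((pairField g (n + 1))ᴴ * pairField g (n + 1))).minEnergyOn
            (szSector (Λ := FermionTorus 2 (n + 1)) N Mz) +
          s * c * ((n + 1 : ℕ) : ℝ) ^ 4 / 2) *
        (projMatrix ((szSector (Λ := FermionTorus 2 (n + 1)) N Mz).map
            ((WithLp.linearEquiv 2 ℂ (Fock (Orb (FermionTorus 2 (n + 1))))).symm :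
              Fock (Orb (FermionTorus 2 (n + 1))) →ₗ[ℂ]
                EuclideanSpace ℂ (Finset (Orb (FermionTorus 2 (n + 1)))))) *
          gibbsWeight β (hubbardTorus 2 (n + 1) t U + (s : ℂ) •
            ((pairField g (n + 1))ᴴ * pairField g (n + 1)))).trace.re)
    (hth : c * ((n + 1 : ℕ) : ℝ) ^ 4 ≤
      ((projMatrix ((szSector (Λ := FermionTorus 2 (n + 1)) N Mz).map
            ((WithLp.linearEquiv 2 ℂ (Fock (Orb (FermionTorus 2 (n + 1))))).symm :
              Fock (Orb (FermionTorus 2 (n + 1))) →ₗ[ℂ]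
                EuclideanSpace ℂ (Finset (Orb (FermionTorus 2 (n + 1)))))) *
          gibbsWeight β (hubbardTorus 2 (n + 1) t U + (s : ℂ) •
            ((pairField g (n + 1))ᴴ * pairField g (n + 1))) *
          ((pairField g (n + 1))ᴴ * pairField g (n + 1))).trace /
        (projMatrix ((szSector (Λ := FermionTorus 2 (n + 1)) N Mz).map
            ((WithLp.linearEquiv 2 ℂ (Fock (Orb (FermionTorus 2 (n + 1))))).symm :
              Fock (Orb (FermionTorus 2 (n + 1))) →ₗ[ℂ]
                EuclideanSpace ℂ (Finset (Orb (FermionTorus 2 (n + 1)))))) *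
          gibbsWeight β (hubbardTorus 2 (n + 1) t U + (s : ℂ) •
            ((pairField g (n + 1))ᴴ * pairField g (n + 1)))).trace).re) :
    s * c * ((n + 1 : ℕ) : ℝ) ^ 4 ≤ 192 * Real.pi ^ 2 * |t| * (M : ℝ) ^ 2 := by
  set K : Submodule ℂ (Fock (Orb (FermionTorus 2 (n + 1)))) := szSector N Mz with hK
  set H := hubbardTorus 2 (n + 1) t U with hH
  set Δ := pairField g (n + 1) with hΔ
  set O := Δᴴ * Δ with hO
  set A := H + ((s / 4 : ℝ) : ℂ) • O with hA
  have hdecomp : H + (s : ℂ) • O = A + ((3 * s / 4 : ℝ) : ℂ) • O := by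
    rw [hA, add_assoc, ← add_smul, ← Complex.ofReal_add]
    congr 2
    ring
  have hAh : A.IsHermitian := isHermitian_penalised t U (s / 4) g
  have hOh : O.IsHermitian := isHermitian_conjTranspose_mul_self _
  have hKA : ∀ v ∈ K, A *ᵥ v ∈ K := fun v hv => penalised_mulVec_mem_szSector t U (s / 4) g hN2 hv
  have hKO : ∀ v ∈ K, O *ᵥ v ∈ K := by
    intro v hv
    rw [hO, ← mulVec_mulVec]
    have h := PairTower.pairField_conjTranspose_mulVec_mem_szSector g
      (PairTower.pairField_mulVec_mem_szSector g hv)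
    rwa [Nat.sub_add_cancel hN2] at h
  obtain ⟨φ, hφK, hφ1, hφA⟩ := exists_unit_eigen_minEnergyOn hAh K hKA hKne
  rw [hdecomp] at henergy hth
  have hs' : 0 < 3 * s / 4 := by positivity
  have hφO := groundState_re_rayleigh_ge_of_sectorGibbs_penalised_energy hAh hOh K hKA hKO hs' β
    henergy hth hφK hφ1 hφA
  have hs0 : s ≠ 0 := hs.ne'
  have hε : s * c * ((n + 1 : ℕ) : ℝ) ^ 4 / 2 / (3 * s / 4) =
      2 * (c * ((n + 1 : ℕ) : ℝ) ^ 4) / 3 := by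
    field_simp
    ring
  rw [hε] at hφO
  have hord' : c / 3 * ((n + 1 : ℕ) : ℝ) ^ 4 ≤ (star (Δ *ᵥ φ) ⬝ᵥ (Δ *ᵥ φ)).re := by
    have h : (star φ ⬝ᵥ (O *ᵥ φ)).re = (star (Δ *ᵥ φ) ⬝ᵥ (Δ *ᵥ φ)).re := by
      rw [hO, ← mulVec_mulVec, dotProduct_mulVec _ Δᴴ, ← star_mulVec]
    rw [← h]
    linarith
  have hgs : IsGroundStateInSector
      (hubbardTorus 2 (n + 1) t U + ((s / 4 : ℝ) : ℂ) •
        ((pairField g (n + 1))ᴴ * pairField g (n + 1))) N Mz φ :=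
    ⟨hφK, fun h0 => by simp [h0] at hφ1, hφA⟩
  have hMc' : 800 ≤ (M : ℝ) * (c / 3) := by linarith
  have hkey := penalty_mul_order_le_of_penalised_groundState hL t U g hg (s := s / 4) (c := c / 3)
    (by positivity) hML hMc' hgs hφ1 hord'
  linarith

/-- **The energy tolerance of the primal form is `L`-independent.** In the criterion
`hubbardSuperconductivity_iff_approx_penalised_state` (`t = 1`, d-wave, doped `S^z = 0` sector),
at every even side `L = n+1 ≥ 3` with `⌈2400/c⌉ < L`, every admissible witness — `s > 0` and a unit
`χ` of the sector with penalised energy within `s c L⁴/2` of the penalised sector ground energy and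
order `≥ c L⁴` — has `s ≤ 192 π² ⌈2400/c⌉² / (c L⁴)` and `s c L⁴ / 2 ≤ 96 π² ⌈2400/c⌉²`.
[this work] -/
theorem one_state_energy_tolerance (U : ℝ) {δ c : ℝ} (hδ : δ ∈ Set.Ioo (0 : ℝ) (1 / 2))
    (hc : 0 < c) {n : ℕ} (hn : Even (n + 1)) (hL : 3 ≤ n + 1) (hLc : ⌈2400 / c⌉₊ < n + 1)
    {s : ℝ} (hs : 0 < s) {χ : Fock (Orb (FermionTorus 2 (n + 1)))} (hχ1 : star χ ⬝ᵥ χ = 1)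
    (hχK : χ ∈ szSector (Λ := FermionTorus 2 (n + 1))
      (2 * ⌊(1 - δ) * ((n + 1 : ℕ) : ℝ) ^ 2 / 2⌋₊) 0)
    (hχE : (star χ ⬝ᵥ (hubbardTorus 2 (n + 1) 1 U + (s : ℂ) •
        ((pairField dWaveFormFactor (n + 1))ᴴ * pairField dWaveFormFactor (n + 1))) *ᵥ χ).re ≤
      (hubbardTorus 2 (n + 1) 1 U + (s : ℂ) •
          ((pairField dWaveFormFactor (n + 1))ᴴ * pairField dWaveFormFactor (n + 1))
        ).minEnergyOn (szSector (Λ := FermionTorus 2 (n + 1))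
          (2 * ⌊(1 - δ) * ((n + 1 : ℕ) : ℝ) ^ 2 / 2⌋₊) 0) +
        s * c * ((n + 1 : ℕ) : ℝ) ^ 4 / 2)
    (hord : c * ((n + 1 : ℕ) : ℝ) ^ 4 ≤
      (expect ((pairField dWaveFormFactor (n + 1))ᴴ * pairField dWaveFormFactor (n + 1)) χ).re) :
    s ≤ 192 * Real.pi ^ 2 * (⌈2400 / c⌉₊ : ℝ) ^ 2 / (c * ((n + 1 : ℕ) : ℝ) ^ 4) ∧
      s * c * ((n + 1 : ℕ) : ℝ) ^ 4 / 2 ≤ 96 * Real.pi ^ 2 * (⌈2400 / c⌉₊ : ℝ) ^ 2 := by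
  obtain ⟨hN2, hKne⟩ := dopedSector_two_le_and_ne_bot U hδ hn
  have hMc : 2400 ≤ (⌈2400 / c⌉₊ : ℝ) * c := by
    have h := Nat.le_ceil (2400 / c)
    rw [div_le_iff₀ hc] at h
    exact h
  have h1 := approx_penalised_penalty_ceiling hL 1 U dWaveFormFactor
    GaugeTwist.abs_dWaveFormFactor_le_one hN2 hKne hs hLc hMc hχK hχ1 hχE hord
  rw [abs_one, mul_one] at h1
  have hL4 : (0 : ℝ) < ((n + 1 : ℕ) : ℝ) ^ 4 := by positivity
  refine ⟨?_, by linarith⟩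
  rw [le_div_iff₀ (mul_pos hc hL4)]
  nlinarith [h1]

/-- **The energy tolerance of the thermal form is `L`-independent.** In the criterion of
`hubbardSuperconductivity_of_penalised_thermal_energy` (`t = 1`, d-wave, doped `S^z = 0` sector),
at every even side `L = n+1 ≥ 3` with `⌈2400/c⌉ < L`, every admissible triple — `s > 0`, any `β`,
the canonical sector Gibbs state of `H_L + s Δ_d†Δ_d` with thermal excitation energy `≤ s c L⁴/2`
(times `Z_K`) and order `≥ c L⁴` — has `s ≤ 192 π² ⌈2400/c⌉² / (c L⁴)` and
`s c L⁴ / 2 ≤ 96 π² ⌈2400/c⌉²`: the route needs the TOTAL thermal excitation energy of the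
penalised model in the sector to be `O(1/c²)`, uniformly in `L`. [this work] -/
theorem one_gibbs_state_energy_tolerance (U : ℝ) {δ c : ℝ} (hδ : δ ∈ Set.Ioo (0 : ℝ) (1 / 2))
    (hc : 0 < c) {n : ℕ} (hn : Even (n + 1)) (hL : 3 ≤ n + 1) (hLc : ⌈2400 / c⌉₊ < n + 1)
    {s : ℝ} (hs : 0 < s) (β : ℝ)
    (henergy : (projMatrix ((szSector (Λ := FermionTorus 2 (n + 1))
              (2 * ⌊(1 - δ) * ((n + 1 : ℕ) : ℝ) ^ 2 / 2⌋₊) 0).map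
            ((WithLp.linearEquiv 2 ℂ (Fock (Orb (FermionTorus 2 (n + 1))))).symm :
              Fock (Orb (FermionTorus 2 (n + 1))) →ₗ[ℂ]
                EuclideanSpace ℂ (Finset (Orb (FermionTorus 2 (n + 1)))))) *
          gibbsWeight β (hubbardTorus 2 (n + 1) 1 U + (s : ℂ) •
            ((pairField dWaveFormFactor (n + 1))ᴴ * pairField dWaveFormFactor (n + 1))) *
          (hubbardTorus 2 (n + 1) 1 U + (s : ℂ) •
            ((pairField dWaveFormFactor (n + 1))ᴴ * pairField dWaveFormFactor (n + 1)))
        ).trace.re ≤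
        ((hubbardTorus 2 (n + 1) 1 U + (s : ℂ) •
            ((pairField dWaveFormFactor (n + 1))ᴴ * pairField dWaveFormFactor (n + 1))
            ).minEnergyOn (szSector (Λ := FermionTorus 2 (n + 1))
              (2 * ⌊(1 - δ) * ((n + 1 : ℕ) : ℝ) ^ 2 / 2⌋₊) 0) +
          s * c * ((n + 1 : ℕ) : ℝ) ^ 4 / 2) *
        (projMatrix ((szSector (Λ := FermionTorus 2 (n + 1))
              (2 * ⌊(1 - δ) * ((n + 1 : ℕ) : ℝ) ^ 2 / 2⌋₊) 0).map
            ((WithLp.linearEquiv 2 ℂ (Fock (Orb (FermionTorus 2 (n + 1))))).symm :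
              Fock (Orb (FermionTorus 2 (n + 1))) →ₗ[ℂ]
                EuclideanSpace ℂ (Finset (Orb (FermionTorus 2 (n + 1)))))) *
          gibbsWeight β (hubbardTorus 2 (n + 1) 1 U + (s : ℂ) •
            ((pairField dWaveFormFactor (n + 1))ᴴ * pairField dWaveFormFactor (n + 1)))
        ).trace.re)
    (hth : c * ((n + 1 : ℕ) : ℝ) ^ 4 ≤
      ((projMatrix ((szSector (Λ := FermionTorus 2 (n + 1))
              (2 * ⌊(1 - δ) * ((n + 1 : ℕ) : ℝ) ^ 2 / 2⌋₊) 0).map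
            ((WithLp.linearEquiv 2 ℂ (Fock (Orb (FermionTorus 2 (n + 1))))).symm :
              Fock (Orb (FermionTorus 2 (n + 1))) →ₗ[ℂ]
                EuclideanSpace ℂ (Finset (Orb (FermionTorus 2 (n + 1)))))) *
          gibbsWeight β (hubbardTorus 2 (n + 1) 1 U + (s : ℂ) •
            ((pairField dWaveFormFactor (n + 1))ᴴ * pairField dWaveFormFactor (n + 1))) *
          ((pairField dWaveFormFactor (n + 1))ᴴ * pairField dWaveFormFactor (n + 1))).trace /
        (projMatrix ((szSector (Λ := FermionTorus 2 (n + 1))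
              (2 * ⌊(1 - δ) * ((n + 1 : ℕ) : ℝ) ^ 2 / 2⌋₊) 0).map
            ((WithLp.linearEquiv 2 ℂ (Fock (Orb (FermionTorus 2 (n + 1))))).symm :
              Fock (Orb (FermionTorus 2 (n + 1))) →ₗ[ℂ]
                EuclideanSpace ℂ (Finset (Orb (FermionTorus 2 (n + 1)))))) *
          gibbsWeight β (hubbardTorus 2 (n + 1) 1 U + (s : ℂ) •
            ((pairField dWaveFormFactor (n + 1))ᴴ *
              pairField dWaveFormFactor (n + 1)))).trace).re) :
    s ≤ 192 * Real.pi ^ 2 * (⌈2400 / c⌉₊ : ℝ) ^ 2 / (c * ((n + 1 : ℕ) : ℝ) ^ 4) ∧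
      s * c * ((n + 1 : ℕ) : ℝ) ^ 4 / 2 ≤ 96 * Real.pi ^ 2 * (⌈2400 / c⌉₊ : ℝ) ^ 2 := by
  obtain ⟨hN2, hKne⟩ := dopedSector_two_le_and_ne_bot U hδ hn
  have hMc : 2400 ≤ (⌈2400 / c⌉₊ : ℝ) * c := by
    have h := Nat.le_ceil (2400 / c)
    rw [div_le_iff₀ hc] at h
    exact h
  have h1 := thermal_energy_penalty_ceiling hL 1 U dWaveFormFactor
    GaugeTwist.abs_dWaveFormFactor_le_one hN2 hKne hs β hLc hMc henergy hth
  rw [abs_one, mul_one] at h1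
  have hL4 : (0 : ℝ) < ((n + 1 : ℕ) : ℝ) ^ 4 := by positivity
  refine ⟨?_, by linarith⟩
  rw [le_div_iff₀ (mul_pos hc hL4)]
  nlinarith [h1]

end Summit.HubbardSuperconductivity.HubbardSuperconductivity.Theorems

end
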